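import Summits.AtomisticToContinuum.Crystallization.Theorems.OverbindingBudgetAffineCalmDescentA

/-!
# OverbindingBudget · 31280 line (2c) — NODE «CalmDescent» (lens-4 g102), part B (sequel of `…OverbindingBudgetAffineCalmDescentA`): §5 normal form, §6 census glue, §7 record seam

Split for the 400-line cap by the landing lane (hand-2 g49); the module docstring of part A describes the whole node.  Same namespace; all FQNs unchanged.
0 sorry; standard axioms.
-/

namespace Summit.AtomisticToContinuum.Crystallization.Theorems.OverbindingBudgetAffineCalmDescent

open scoped BigOperators Classical
open Literature.MathematicalPhysics.StatisticalMechanics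
open Literature.Geometry.DiscreteGeometry (IsChargeFree nearestDist nearestDist_nonneg nearestDist_le_dist fccTwoShellPattern hcpTwoShellPattern
  bondGraph)
open Summit.AtomisticToContinuum.Crystallization.Theorems.OverbindingBudgetMisfitCensusStatements (Bad Short Long)
open Summit.AtomisticToContinuum.Crystallization.Theorems.OverbindingBudgetMisfitRegistration (Framed Reg DeepReg regScaleCount)
open Summit.AtomisticToContinuum.Crystallization.Theorems.OverbindingBudgetMisfitWindowStatements (InWindow offCount)
open Summit.AtomisticToContinuum.Crystallization.Theorems.OverbindingBudgetBalancedCensusStatements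
open Summit.AtomisticToContinuum.Crystallization.Theorems.OverbindingBudgetAffineLadder
open Summit.AtomisticToContinuum.Crystallization.Theorems.OverbindingBudgetAffineMesoCut
open Summit.AtomisticToContinuum.Crystallization.Theorems.OverbindingBudgetAffinePhaseCut
open Summit.AtomisticToContinuum.Crystallization.Theorems.OverbindingBudgetAffineCushionCut
open Summit.AtomisticToContinuum.Crystallization.Theorems.OverbindingBudgetAffineTwinCut
open Summit.AtomisticToContinuum.Crystallization.Theorems.OverbindingBudgetAffineRunCut
open Summit.AtomisticToContinuum.Crystallization.Theorems.OverbindingBudgetAffineCompressedCut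
open Summit.AtomisticToContinuum.Crystallization.Theorems.OverbindingBudgetAffineRunCutFlat
open Summit.AtomisticToContinuum.Crystallization.Theorems.OverbindingBudgetAffineWildCut
open Summit.AtomisticToContinuum.Crystallization.Theorems.OverbindingBudgetAffineCoreDescent
open Summit.AtomisticToContinuum.Crystallization.Theorems.OverbindingBudgetAffineStrainBand

variable {N : ℕ}

/-! ## §5  The normal form, packing half (PROVED): non-calm MID sites see a witness, calm MID sites see a loose or an optic calm site -/

/-- A `(L + 128/δ)`-deep in-window site that is NOT calm at depth `L` sees within `2L` an off-window, a dilated or an agitated site. [this node] -/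
theorem exists_witness_of_not_calm {δ τ L : ℝ} (hδ : 0 < δ) (hL : 0 ≤ L) {y : Fin N → EuclideanSpace ℝ (Fin 3)} {i : Fin N}
    (hw : InWindow δ 2 y i) (hD : DeepReg (L + 128 / δ) (3 / 50) (1 / 450) y i) (hc : ¬ Calm δ τ L y i) :
    ∃ j : Fin N, (¬ InWindow δ 2 y j ∨ (Dilated δ y j ∨ Agitated δ τ y j)) ∧ dist (y i) (y j) ≤ 2 * L := by
  have h128 : 0 ≤ 128 / δ := div_nonneg (by norm_num) hδ.le
  have hDL : DeepReg L (3 / 50) (1 / 450) y i := deepReg_anti (by linarith) hD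
  have key : ∃ j : Fin N, dist (y j) (y i) ≤ L * nearestDist y i ∧
      ¬ (InWindow δ 2 y j ∧ nearestDist y j ≤ 21 / 20 ∧ ‖ljSiteGrad y j‖ ≤ τ) := by
    by_contra hne
    exact hc ⟨hDL, fun i' hi' => by
      by_contra hx
      exact hne ⟨i', hi', hx⟩⟩
  obtain ⟨j, hj, hj'⟩ := key
  refine ⟨j, ?_, ?_⟩
  · by_cases hwj : InWindow δ 2 y j
    · right
      by_cases htj : nearestDist y j ≤ 21 / 20
      · right
        have hg : ¬ ‖ljSiteGrad y j‖ ≤ τ := fun hg => hj' ⟨hwj, htj, hg⟩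
        exact ⟨hwj, (not_le.1 hg).le⟩
      · left
        refine ⟨?_, hwj, not_le.1 htj⟩
        intro k hk
        apply hD k
        have hnj : nearestDist y j ≤ 2 := hwj.2
        have hni : δ ≤ nearestDist y i := hw.1
        have h1 : 64 * nearestDist y j ≤ 128 := by linarith
        have h2 : (128 : ℝ) ≤ 128 / δ * nearestDist y i := by
          rw [div_mul_eq_mul_div, le_div_iff₀ hδ]
          nlinarith
        calc dist (y k) (y i) ≤ dist (y k) (y j) + dist (y j) (y i) := dist_triangle _ _ _
          _ ≤ 64 * nearestDist y j + L * nearestDist y i := add_le_add hk hj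
          _ ≤ (L + 128 / δ) * nearestDist y i := by nlinarith
    · exact Or.inl hwj
  · calc dist (y i) (y j) = dist (y j) (y i) := dist_comm _ _
      _ ≤ L * nearestDist y i := hj
      _ ≤ L * 2 := mul_le_mul_of_nonneg_left hw.2 hL
      _ = 2 * L := by ring

/-- A calm MID site (calm depth `L ≥ 12 + 128/δ`) sees within `12·nn ≤ 24` a loose or an optic calm site of depth `R`, homogeneous on its whole
`R`-ball, provided rigidity holds at calm depth `L₀` and `R + 2L₀/δ ≤ (L − 12)δ/2` (every site of the witness's `R`-ball is still `L₀`-calm). [this node] -/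
theorem exists_loose_or_optic_of_calm_mid {δ τ L L₀ R η₂ : ℝ} (hδ : 0 < δ) (hL₀ : 0 ≤ L₀) (hR : 0 ≤ R) (hL : 12 + 128 / δ ≤ L)
    (hLR : R + 2 * L₀ / δ ≤ (L - 12) * δ / 2) {y : Fin N → EuclideanSpace ℝ (Fin 3)}
    (hrig : ∀ i' : Fin N, Calm δ τ L₀ y i' → OptDeepReg 12 η₂ (1 / 10) (1 / 450) y i') {i : Fin N} (hc : Calm δ τ L y i)
    (hM : ¬ AffDeepReg 12 (1 / 10 ^ 4) (1 / 25) (1 / 450) y i) :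
    ∃ j : Fin N, (LooseCalmSite δ η₂ τ R y j ∨ OpticCalmSite δ η₂ τ R y j) ∧ dist (y i) (y j) ≤ 24 := by
  have h128 : 0 ≤ 128 / δ := div_nonneg (by norm_num) hδ.le
  have hL12 : 12 ≤ L := by linarith
  have hA0 : 0 ≤ 2 * L₀ / δ := div_nonneg (by linarith) hδ.le
  have hRL' : R ≤ (L - 12) * δ / 2 := by linarith
  have key : ∃ j : Fin N, dist (y j) (y i) ≤ 12 * nearestDist y i ∧ ¬ AffReg (1 / 10 ^ 4) (1 / 25) (1 / 450) y j := by
    by_contra hne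
    exact hM fun i' hi' => by
      by_contra hx
      exact hne ⟨i', hi', hx⟩
  obtain ⟨j, hj, hjA⟩ := key
  have hwi : InWindow δ 2 y i := (hc.2 i (by rw [dist_self]; exact mul_nonneg (by linarith) (nearestDist_nonneg y i))).1
  have hwj : InWindow δ 2 y j := (hc.2 j (hj.trans (mul_le_mul_of_nonneg_right hL12 (nearestDist_nonneg y i)))).1
  have hcj' : Calm δ τ ((L - 12) * δ / 2) y j := calm_of_near hδ (by norm_num) hL12 hc hj
  have hcj : Calm δ τ R y j := calm_anti le_rfl hRL' hcj'
  -- every site of the `R`-ball of `j` is calm at depth `((L-12)δ/2 − R)·δ/2 ≥ L₀`, hence `OptReg η₂` by rigidity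
  have hOj : OptDeepReg R η₂ (1 / 10) (1 / 450) y j := by
    intro i' hi'
    have hci' : Calm δ τ (((L - 12) * δ / 2 - R) * δ / 2) y i' := calm_of_near hδ hR hRL' hcj' hi'
    have hdepth : L₀ ≤ ((L - 12) * δ / 2 - R) * δ / 2 := by
      have h1 : 2 * L₀ / δ ≤ (L - 12) * δ / 2 - R := by linarith
      have h2 : 2 * L₀ / δ * δ = 2 * L₀ := div_mul_cancel₀ _ hδ.ne'
      nlinarith
    exact optReg_of_optDeepReg (by norm_num) (hrig i' (calm_anti le_rfl hdepth hci'))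
  -- `j` is `64`-deep: its `64·nn_j`-ball lies in the `L·nn_i`-ball of `i` (`64·nn_j ≤ 128 ≤ (128/δ)·nn_i`)
  have hDj : DeepReg 64 (3 / 50) (1 / 450) y j := by
    intro k hk
    apply hc.1 k
    have hnj : nearestDist y j ≤ 2 := hwj.2
    have hni : δ ≤ nearestDist y i := hwi.1
    have h1 : 64 * nearestDist y j ≤ 128 := by linarith
    have h2 : (128 : ℝ) ≤ 128 / δ * nearestDist y i := by
      rw [div_mul_eq_mul_div, le_div_iff₀ hδ]
      nlinarith
    have h3 : (12 + 128 / δ) * nearestDist y i ≤ L * nearestDist y i := mul_le_mul_of_nonneg_right hL (nearestDist_nonneg y i)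
    calc dist (y k) (y i) ≤ dist (y k) (y j) + dist (y j) (y i) := dist_triangle _ _ _
      _ ≤ 64 * nearestDist y j + 12 * nearestDist y i := add_le_add hk hj
      _ ≤ (12 + 128 / δ) * nearestDist y i := by nlinarith
      _ ≤ L * nearestDist y i := h3
  refine ⟨j, ?_, ?_⟩
  · by_cases hA : AffReg (1 / 10 ^ 4) (1 / 10) (1 / 450) y j
    · exact Or.inl ⟨hDj, hcj, hOj, hA, hjA⟩
    · exact Or.inr ⟨hDj, hcj, hOj, hA⟩
  · calc dist (y i) (y j) = dist (y j) (y i) := dist_comm _ _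
      _ ≤ 12 * nearestDist y i := hj
      _ ≤ 12 * 2 := mul_le_mul_of_nonneg_left hwi.2 (by norm_num)
      _ = 24 := by norm_num

/-- **THE POINTWISE NORMAL FORM.**  At MID depth `L⁺ = L + 128/δ` (calm depth `L ≥ 12 + 128/δ`), rigidity at calm depth `L₀`, witness depth `R ≥ 0`
with `R + 2L₀/δ ≤ (L − 12)δ/2`:
`#MID(L⁺) ≤ 27(4L+δ)³/δ³ · (#off + #dilated + #agitated) + 27(48+δ)³/δ³ · (#looseCalm + #opticCalm)(δ, η₂, τ, R) + 2·#off`. [this node] -/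
theorem affMidCount_le_calm_split {δ τ L L₀ R η₂ : ℝ} (hδ : 0 < δ) (hL₀ : 0 ≤ L₀) (hR : 0 ≤ R) (hL : 12 + 128 / δ ≤ L)
    (hLR : R + 2 * L₀ / δ ≤ (L - 12) * δ / 2) {y : Fin N → EuclideanSpace ℝ (Fin 3)} (hy : Function.Injective y)
    (hrig : ∀ i : Fin N, Calm δ τ L₀ y i → OptDeepReg 12 η₂ (1 / 10) (1 / 450) y i) :
    (affMidCount (L + 128 / δ) 12 (1 / 10 ^ 4) (1 / 25) (3 / 50) (1 / 450) y : ℝ) ≤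
      27 / δ ^ 3 * (2 * (2 * L) + δ) ^ 3 * (offCount δ 2 y + dilatedCount δ y + agitCount δ τ y)
        + 27 / δ ^ 3 * (2 * 24 + δ) ^ 3 * (looseCalmCount δ η₂ τ R y + opticCalmCount δ η₂ τ R y)
        + 2 * offCount δ 2 y := by
  have h128 : 0 ≤ 128 / δ := div_nonneg (by norm_num) hδ.le
  have hL0 : 0 ≤ L := by linarith
  set Ka : ℝ := 27 / δ ^ 3 * (2 * (2 * L) + δ) ^ 3 with hKa
  set Kb : ℝ := 27 / δ ^ 3 * (2 * 24 + δ) ^ 3 with hKb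
  have hKa0 : 0 ≤ Ka := by
    rw [hKa]; exact mul_nonneg (div_nonneg (by norm_num) (pow_nonneg hδ.le 3)) (pow_nonneg (by linarith) 3)
  have hKb0 : 0 ≤ Kb := by
    rw [hKb]; exact mul_nonneg (div_nonneg (by norm_num) (pow_nonneg hδ.le 3)) (pow_nonneg (by linarith) 3)
  -- (1) excluded middle on calmness
  have h1 : affMidCount (L + 128 / δ) 12 (1 / 10 ^ 4) (1 / 25) (3 / 50) (1 / 450) y ≤
      Nat.card {i // (DeepReg (L + 128 / δ) (3 / 50) (1 / 450) y i ∧ ¬ AffDeepReg 12 (1 / 10 ^ 4) (1 / 25) (1 / 450) y i) ∧ Calm δ τ L y i}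
      + Nat.card {i // (DeepReg (L + 128 / δ) (3 / 50) (1 / 450) y i ∧ ¬ AffDeepReg 12 (1 / 10 ^ 4) (1 / 25) (1 / 450) y i) ∧ ¬ Calm δ τ L y i} := by
    unfold affMidCount
    exact natCard_le_add_of_imp fun i hi => by
      by_cases hc : Calm δ τ L y i
      · exact Or.inl ⟨hi, hc⟩
      · exact Or.inr ⟨hi, hc⟩
  -- (2) calm MID sites: a loose or optic calm witness within `24`
  have h2 : (Nat.card {i // (DeepReg (L + 128 / δ) (3 / 50) (1 / 450) y i ∧ ¬ AffDeepReg 12 (1 / 10 ^ 4) (1 / 25) (1 / 450) y i) ∧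
        Calm δ τ L y i} : ℝ) ≤
      Kb * Nat.card {j // LooseCalmSite δ η₂ τ R y j ∨ OpticCalmSite δ η₂ τ R y j} + offCount δ 2 y := by
    rw [hKb]
    refine natCard_le_mul_of_witness hδ (by norm_num) hy fun i _ hP => ?_
    exact exists_loose_or_optic_of_calm_mid hδ hL₀ hR hL hLR hrig hP.2 hP.1.2
  have h2' : Nat.card {j // LooseCalmSite δ η₂ τ R y j ∨ OpticCalmSite δ η₂ τ R y j} ≤
      looseCalmCount δ η₂ τ R y + opticCalmCount δ η₂ τ R y := by
    unfold looseCalmCount opticCalmCount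
    exact natCard_le_add_of_imp fun j hj => hj
  -- (3) non-calm MID sites: an off-window, dilated or agitated witness within `2L`
  have h3 : (Nat.card {i // (DeepReg (L + 128 / δ) (3 / 50) (1 / 450) y i ∧ ¬ AffDeepReg 12 (1 / 10 ^ 4) (1 / 25) (1 / 450) y i) ∧
        ¬ Calm δ τ L y i} : ℝ) ≤
      Ka * Nat.card {j // ¬ InWindow δ 2 y j ∨ (Dilated δ y j ∨ Agitated δ τ y j)} + offCount δ 2 y := by
    rw [hKa]
    refine natCard_le_mul_of_witness hδ (by linarith) hy fun i hw hP => ?_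
    exact exists_witness_of_not_calm hδ hL0 hw hP.1.1 hP.2
  have h3' : Nat.card {j // ¬ InWindow δ 2 y j ∨ (Dilated δ y j ∨ Agitated δ τ y j)} ≤
      offCount δ 2 y + (dilatedCount δ y + agitCount δ τ y) := by
    have ha : Nat.card {j // ¬ InWindow δ 2 y j ∨ (Dilated δ y j ∨ Agitated δ τ y j)} ≤
        Nat.card {j // ¬ InWindow δ 2 y j} + Nat.card {j // Dilated δ y j ∨ Agitated δ τ y j} :=
      natCard_le_add_of_imp fun j hj => hj
    have hb : Nat.card {j // Dilated δ y j ∨ Agitated δ τ y j} ≤ dilatedCount δ y + agitCount δ τ y := by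
      unfold dilatedCount agitCount
      exact natCard_le_add_of_imp fun j hj => hj
    have hc : Nat.card {j // ¬ InWindow δ 2 y j} = offCount δ 2 y := rfl
    omega
  -- (4) assemble over ℝ
  have h1r : (affMidCount (L + 128 / δ) 12 (1 / 10 ^ 4) (1 / 25) (3 / 50) (1 / 450) y : ℝ) ≤
      (Nat.card {i // (DeepReg (L + 128 / δ) (3 / 50) (1 / 450) y i ∧ ¬ AffDeepReg 12 (1 / 10 ^ 4) (1 / 25) (1 / 450) y i) ∧ Calm δ τ L y i} : ℝ)
      + (Nat.card {i // (DeepReg (L + 128 / δ) (3 / 50) (1 / 450) y i ∧ ¬ AffDeepReg 12 (1 / 10 ^ 4) (1 / 25) (1 / 450) y i) ∧ ¬ Calm δ τ L y i} : ℝ) := by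
    exact_mod_cast h1
  have h2r : (Nat.card {j // LooseCalmSite δ η₂ τ R y j ∨ OpticCalmSite δ η₂ τ R y j} : ℝ) ≤
      (looseCalmCount δ η₂ τ R y : ℝ) + (opticCalmCount δ η₂ τ R y : ℝ) := by
    exact_mod_cast h2'
  have h3r : (Nat.card {j // ¬ InWindow δ 2 y j ∨ (Dilated δ y j ∨ Agitated δ τ y j)} : ℝ) ≤
      (offCount δ 2 y : ℝ) + ((dilatedCount δ y : ℝ) + (agitCount δ τ y : ℝ)) := by
    exact_mod_cast h3'
  have e2 := mul_le_mul_of_nonneg_left h2r hKb0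
  have e3 := mul_le_mul_of_nonneg_left h3r hKa0
  linarith

/-! ## §6  The census glue (PROVED): one window, then `CoarseMid` -/

/-- **One window.**  At `0 < δ ≤ 2`, calm depth `L ≥ 12 + 128/δ`, rigidity at calm depth `L₀`, witness depth `R ≥ 0` with
`R + 2L₀/δ ≤ (L−12)δ/2`: the censuses of the agitated, the dilated, the loose-calm and the optic-calm sites (the latter two at `(δ, η₂, τ, R)`) give
the MID census at depth `L + 128/δ`. [this node] -/
theorem midW_of_pieces {δ τ L L₀ R η₂ : ℝ} (hδ : 0 < δ) (hL₀ : 0 ≤ L₀) (hR : 0 ≤ R) (hL : 12 + 128 / δ ≤ L)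
    (hLR : R + 2 * L₀ / δ ≤ (L - 12) * δ / 2)
    (hrig : ∀ (N : ℕ) (y : Fin N → EuclideanSpace ℝ (Fin 3)), Function.Injective y →
      ∀ i : Fin N, Calm δ τ L₀ y i → OptDeepReg 12 η₂ (1 / 10) (1 / 450) y i)
    (hAg : CensusW (fun y => agitCount δ τ y) (fun y => notDeepCount 64 (3 / 50) (1 / 450) y) δ 2)
    (hDi : CensusW (fun y => dilatedCount δ y) (fun y => notDeepCount 64 (3 / 50) (1 / 450) y) δ 2)
    (hLo : CensusW (fun y => looseCalmCount δ η₂ τ R y) (fun y => notDeepCount 64 (3 / 50) (1 / 450) y) δ 2)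
    (hOp : CensusW (fun y => opticCalmCount δ η₂ τ R y) (fun y => notDeepCount 64 (3 / 50) (1 / 450) y) δ 2) :
    CensusW (fun y => affMidCount (L + 128 / δ) 12 (1 / 10 ^ 4) (1 / 25) (3 / 50) (1 / 450) y)
      (fun y => notDeepCount 64 (3 / 50) (1 / 450) y) δ 2 := by
  have hsum := censusW_add (censusW_add (censusW_add hAg hDi) hLo) hOp
  set Ka : ℝ := 27 / δ ^ 3 * (2 * (2 * L) + δ) ^ 3 with hKa
  set Kb : ℝ := 27 / δ ^ 3 * (2 * 24 + δ) ^ 3 with hKb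
  have h128 : 0 ≤ 128 / δ := div_nonneg (by norm_num) hδ.le
  have hKa0 : 0 ≤ Ka := by
    rw [hKa]; exact mul_nonneg (div_nonneg (by norm_num) (pow_nonneg hδ.le 3)) (pow_nonneg (by linarith) 3)
  have hKb0 : 0 ≤ Kb := by
    rw [hKb]; exact mul_nonneg (div_nonneg (by norm_num) (pow_nonneg hδ.le 3)) (pow_nonneg (by linarith) 3)
  refine censusW_of_le_mul (K := Ka + Kb + 2) (by linarith) (fun y hy => ?_) hsum
  have h := affMidCount_le_calm_split hδ hL₀ hR hL hLR hy (hrig _ y hy)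
  rw [← hKa, ← hKb] at h
  have n1 : (0 : ℝ) ≤ offCount δ 2 y := Nat.cast_nonneg _
  have n2 : (0 : ℝ) ≤ dilatedCount δ y := Nat.cast_nonneg _
  have n3 : (0 : ℝ) ≤ agitCount δ τ y := Nat.cast_nonneg _
  have n4 : (0 : ℝ) ≤ looseCalmCount δ η₂ τ R y := Nat.cast_nonneg _
  have n5 : (0 : ℝ) ≤ opticCalmCount δ η₂ τ R y := Nat.cast_nonneg _
  have n6 : (0 : ℝ) ≤ notDeepCount 64 (3 / 50) (1 / 450) y := Nat.cast_nonneg _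
  push_cast
  nlinarith [mul_nonneg hKa0 n1, mul_nonneg hKa0 n2, mul_nonneg hKa0 n3, mul_nonneg hKa0 n4, mul_nonneg hKa0 n5, mul_nonneg hKa0 n6,
    mul_nonneg hKb0 n1, mul_nonneg hKb0 n2, mul_nonneg hKb0 n3, mul_nonneg hKb0 n4, mul_nonneg hKb0 n5, mul_nonneg hKb0 n6]

/-- **`CoarseMid ⟸ AgitGain ∧ DilatedDeep ∧ CalmRigidity ∧ LooseCalm ∧ OpticCalm`.**  Per window: `η₂ := min η₂ᴸ η₂ᴼ` (the calm counts are
monotone in `η₂`), `τ := min τ_rig τ₁ᴸ τ₁ᴼ`; rigidity at `(η₂, τ)` holds from calm depth `L_rig` (calmness is antitone); witness depth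
`R := max L₁ᴸ L₁ᴼ 0`; calm depth `L := max L_rig (12 + 2(R + 2L_rig/δ + 64)/δ)`, so that `L ≥ 12 + 128/δ` and `R + 2L_rig/δ ≤ (L − 12)δ/2`; glue at
MID depth `L + 128/δ` (`midW_of_pieces`), then return to depth `64` (`affMidCount_depth_le`, `notDeepCount_depth_le`). [this node] -/
theorem coarseMid_of_pieces (hAg : AgitGain) (hDi : DilatedDeep) (hR : CalmRigidity) (hLo : LooseCalm) (hOp : OpticCalm) : CoarseMid := by
  intro δ hδ hδ2
  obtain ⟨ηL, τL, LL, hηL, hτL, hbandL⟩ := hLo δ hδ hδ2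
  obtain ⟨ηO, τO, LO, hηO, hτO, hbandO⟩ := hOp δ hδ hδ2
  obtain ⟨τ₀, L₀, hτ₀, hL₀, hrig⟩ := hR δ hδ hδ2 (min ηL ηO) (lt_min hηL hηO)
  have h128 : 0 ≤ 128 / δ := div_nonneg (by norm_num) hδ.le
  -- the common parameters
  set η₂ : ℝ := min ηL ηO with hη₂
  set τ : ℝ := min τ₀ (min τL τO) with hτ
  set M : ℝ := max (max LL LO) 0 with hM
  set L : ℝ := max L₀ (12 + 2 * (M + 2 * L₀ / δ + 64) / δ) with hLdef
  have hτpos : 0 < τ := lt_min hτ₀ (lt_min hτL hτO)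
  have hτ0 : τ ≤ τ₀ := min_le_left _ _
  have hτL' : τ ≤ τL := (min_le_right _ _).trans (min_le_left _ _)
  have hτO' : τ ≤ τO := (min_le_right _ _).trans (min_le_right _ _)
  have hM0 : 0 ≤ M := le_max_right _ _
  have hMLL : LL ≤ M := (le_max_left _ _).trans (le_max_left _ _)
  have hMLO : LO ≤ M := (le_max_right _ _).trans (le_max_left _ _)
  have hA0 : 0 ≤ 2 * L₀ / δ := div_nonneg (by linarith) hδ.le
  have hLge : 12 + 2 * (M + 2 * L₀ / δ + 64) / δ ≤ L := le_max_right _ _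
  have hL12 : 12 + 128 / δ ≤ L := by
    have hδle : 0 ≤ δ := hδ.le
    have h2 : 128 / δ ≤ 2 * (M + 2 * L₀ / δ + 64) / δ := by
      gcongr
      linarith
    linarith
  have hLR : M + 2 * L₀ / δ ≤ (L - 12) * δ / 2 := by
    have h2 : 2 * (M + 2 * L₀ / δ + 64) / δ * δ = 2 * (M + 2 * L₀ / δ + 64) := div_mul_cancel₀ _ hδ.ne'
    have h3 : (L - 12) * δ ≥ 2 * (M + 2 * L₀ / δ + 64) / δ * δ := by nlinarith
    linarith
  -- rigidity at the common `(η₂, τ)`, from calm depth `L₀`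
  have hrig' : ∀ (N : ℕ) (y : Fin N → EuclideanSpace ℝ (Fin 3)), Function.Injective y →
      ∀ i : Fin N, Calm δ τ L₀ y i → OptDeepReg 12 η₂ (1 / 10) (1 / 450) y i :=
    fun N y hy i hc => hrig N y hy i (calm_anti hτ0 le_rfl hc)
  -- the two calm censuses at the common parameters (`η₂`-monotonicity)
  have hLoW : CensusW (fun y => looseCalmCount δ η₂ τ M y) (fun y => notDeepCount 64 (3 / 50) (1 / 450) y) δ 2 := by
    refine censusW_mono (fun y => ?_) (fun _ => le_rfl) (hbandL τ M hτpos hτL' hMLL)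
    unfold looseCalmCount
    exact natCard_le_of_imp fun i hi => ⟨hi.1, hi.2.1, optDeepReg_mono le_rfl (min_le_left _ _) hi.2.2.1, hi.2.2.2⟩
  have hOpW : CensusW (fun y => opticCalmCount δ η₂ τ M y) (fun y => notDeepCount 64 (3 / 50) (1 / 450) y) δ 2 := by
    refine censusW_mono (fun y => ?_) (fun _ => le_rfl) (hbandO τ M hτpos hτO' hMLO)
    unfold opticCalmCount
    exact natCard_le_of_imp fun i hi => ⟨hi.1, hi.2.1, optDeepReg_mono le_rfl (min_le_right _ _) hi.2.2.1, hi.2.2.2⟩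
  have hW := midW_of_pieces hδ hL₀ hM0 hL12 hLR hrig' (hAg δ hδ hδ2 τ hτpos) (hDi δ hδ hδ2) hLoW hOpW
  -- return to depth 64
  rw [balancedAffMidGapW_iff_censusW]
  have hLp0 : 0 ≤ L + 128 / δ := by linarith
  set K₁ : ℝ := 27 / δ ^ 3 * (2 * (L + 128 / δ) * 2 + δ) ^ 3 with hK₁
  have hK₁0 : 0 ≤ K₁ := by
    rw [hK₁]; exact mul_nonneg (div_nonneg (by norm_num) (pow_nonneg hδ.le 3)) (pow_nonneg (by nlinarith) 3)
  refine censusW_of_le_mul_add (K := K₁) hK₁0 (fun y hy => ?_) hW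
  have h1n := affMidCount_depth_le (ρ := 64) (L := L + 128 / δ) (ρ₁ := 12) (ε₁ := 1 / 10 ^ 4) (θ := 1 / 25) (ε := 3 / 50) (g := 1 / 450) y
  have h1 : (affMidCount 64 12 (1 / 10 ^ 4) (1 / 25) (3 / 50) (1 / 450) y : ℝ) ≤
      (affMidCount (L + 128 / δ) 12 (1 / 10 ^ 4) (1 / 25) (3 / 50) (1 / 450) y : ℝ) + (notDeepCount (L + 128 / δ) (3 / 50) (1 / 450) y : ℝ) := by
    exact_mod_cast h1n
  have h2 := notDeepCount_depth_le (ρ := 64) (L := L + 128 / δ) (ε := 3 / 50) (g := 1 / 450) (σ₁ := δ) (σ₂ := 2)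
    (by norm_num) hLp0 hδ hδ2 hy
  rw [← hK₁] at h2
  linarith

/-! ## §7  The record seam and the cone with `CoarseMid` discharged -/

/-- **THE RECORD SEAM through the calm descent:
`InterfaceDominance ⟸ SW♭₃₀ ∧ MildBand ∧ StrongBand ∧ (AgitGain ∧ DilatedDeep ∧ CalmRigidity ∧ LooseCalm ∧ OpticCalm) ∧ ThinFault`.** [this node] -/
theorem interfaceDominance_of_swapWide30_calm (hT : StackSwapGainFlatWide30) (hMi : MildBand) (hSt : StrongBand)
    (hAg : AgitGain) (hDi : DilatedDeep) (hR : CalmRigidity) (hLo : LooseCalm) (hOp : OpticCalm) (hF : ThinFault) : InterfaceDominance :=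
  interfaceDominance_of_swapWide30_bands hT hMi hSt (coarseMid_of_pieces hAg hDi hR hLo hOp) hF

/-- **RDEF of record through the calm descent** (tree cone `rdef_of_ceg_shape_strainBand_record` BY NAME, its `CoarseMid` leaf discharged from the
five pieces). [this node] -/
theorem rdef_of_ceg_shape_calmDescent_record
    (hCEG : Summit.AtomisticToContinuum.Crystallization.Theses.PricedLinkCensus.ChargedEnergyGap)
    (hSh : OverbindingBudgetTwoShellShape.TwoShellShape (1 / 100) (3 / 50) (1 / 450))
    (hQH : TameBalancedHexRoughGap 64 12 (1 / 10 ^ 5) (1 / 25) (3 / 50) (1 / 450) 12) (hQ : RoughCubic)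
    (hT : StackSwapGainFlatWide30) (hMi : MildBand) (hSt : StrongBand)
    (hAg : AgitGain) (hDi : DilatedDeep) (hR : CalmRigidity) (hLo : LooseCalm) (hOp : OpticCalm) (hF : ThinFault)
    (hK : ∃ μ₁ μR : ℝ, 0 < μ₁ ∧ 0 < μR ∧ OverbindingBudgetAffineNearCluster.PureMarginStabilityAt (3 / 2000) μ₁ μR 4)
    (hA : AffineChartStraightening)
    (hE : OverbindingBudgetAffineNearCluster.NearLightSkeletonEquilibrium (3 / 2000) 4 6 (1 / 1000) 12 (1 / 25) (1 / 2000) 4 6 320 12)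
    (hCF : OverbindingBudgetAffineNearCluster.NearPricedCoreFloor (3 / 2000) 4 6 (1 / 1000) 12 (1 / 25) (1 / 2000) (1 / (4 * 10 ^ 7) / 4) 4 6 12)
    (hSF : OverbindingBudgetAffineNearCluster.NearPricedShellFloor (3 / 2000) 4 6 (1 / 1000) 12 (1 / 25) (1 / 2000) (1 / (4 * 10 ^ 7) / 4) 4 6 12)
    (hV : OverbindingBudgetAffineNearCluster.ForceContentVisible (3 / 2000) 4 6 (1 / 1000) 12 (1 / 25) (1 / 2000) 4 6)
    (hN : OverbindingBudgetAffineNearCluster.NearSecondOrderFloor (3 / 2000) 4 6 (1 / 1000) 12 (1 / 25) (1 / 2000) (1 / (4 * 10 ^ 7)))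
    (hFA : OverbindingBudgetAffineLocalisation.FarAggregatePricing 12 (1 / 25) (1 / 2000) (1 / (2 * 10 ^ 7)))
    (hFR : FineNonAffinity 12 (1 / 10 ^ 5) (1 / 25))
    (hTT : OverbindingBudgetGradedBareness.CleanlessExcessT) (hRR : OverbindingBudgetCoherentCut.CoherentResidual 10) :
    Summit.AtomisticToContinuum.Crystallization.Theses.OverbindingBudget.RobustDefectLimitWindows :=
  rdef_of_ceg_shape_strainBand_record hCEG hSh hQH hQ hT hMi hSt (coarseMid_of_pieces hAg hDi hR hLo hOp) hF hK hA hE hCF hSF hV hN hFA hFR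
    hTT hRR

end Summit.AtomisticToContinuum.Crystallization.Theorems.OverbindingBudgetAffineCalmDescent
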